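import Mathlib
import Literature.AlgebraicGeometry.Resolution.WeightedResolutionDatum
import Literature.AlgebraicGeometry.Resolution.CobordantBlowupGlobal
import Literature.AlgebraicGeometry.Resolution.ExtendedReesSaturation
import Literature.AlgebraicGeometry.Resolution.Blowups
import Summits.ResolutionOfSingularities.ResolutionOfSingularities.Theorems.WeightedInvariantDatumToEmbeddedStrictTransformCharts
import Summits.ResolutionOfSingularities.ResolutionOfSingularities.Theorems.WeightedInvariantDatumToEmbeddedStrictTransform
import Summits.ResolutionOfSingularities.ResolutionOfSingularities.Theorems.WeightedInvariantDatumToEmbeddedRegular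
import Summits.ResolutionOfSingularities.ResolutionOfSingularities.Theorems.WeightedInvariantWeightedThesisGlobalCobordantPlus
import HarnessLib

/-!
# The strict transform maps to the blow-up downstairs

Topic: `Summits/ResolutionOfSingularities/ResolutionOfSingularities/Theorems`. Stub `stub_qs_lift`
of the line `Sketch` of the crux `Theses.WeightedInvariant.DatumToEmbedded` (statement
`stmt-ResolutionOfSingularities-0572`) of the summit
`Summit.ResolutionOfSingularities.ResolutionOfSingularities`.

Setting (J. Włodarczyk, arXiv:2203.03090, §2.3.3: the torus quotient of the cobordant blow-up
`B₊` is the blow-up of the quotient downstairs). Data: a weighted resolution datum `D`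
(`Literature/…/WeightedResolutionDatum.lean`), a closed immersion `i : X ⟶ Y` of an integral `X`
into `f : Y → Spec k` smooth separated quasi-compact over a perfect field, a morphism
`q : X ⟶ V`, the guard of axiom `(iii)`, the Rees filtration `R'` of the centre with its global
cobordant blow-up `σ₊ : B₊ = R'.plus ⟶ Y` and coordinate `t⁻¹ = R'.toA1 : B ⟶ 𝔸¹`
(`Literature/…/CobordantBlowupGlobal.lean`), the INTEGRAL strict transform
`X' = V(R'.strictTransformPlus (ker i)) ⊆ B₊` over `X` (`σX`), a degree `Dg`, and the identity
(A3) `K · 𝒪_{X'} = E^{Dg}` for the downstairs centre `K = ker (V(J_{Dg}·𝒪_X) ⟶ X ⟶ V)` and the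
exceptional ideal `E = (t⁻¹)|_{X'}`. Conclusion: `K ≠ ⊥`, and every blow-up `ρ : V' ⟶ V` of `V`
along `K` (`IsBlowup`, `Literature/…/Blowups.lean`, Görtz–Wedhorn Def. 13.90) receives
`q' : X' ⟶ V'` over `X ⟶ V` — by the universal property, once `E^{Dg}` is an effective Cartier
divisor on `X'`.

* `ne_bot_of_isEffectiveCartier` — an effective Cartier divisor on a non-empty scheme is not the
  zero ideal sheaf;
* `isEffectiveCartier_comap_pow` — on an INTEGRAL scheme `X'` with a coordinate
  `τ : X' ⟶ 𝔸¹ = Spec ℤ[x]` that is not identically zero (`τ⁻¹(𝔸¹ ∖ 0) ≠ ∅`), all powers of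
  `τ^*(x)` are effective Cartier divisors: on an affine open `W`, `τ^*(x)(W) = (τ♯x|_W)`
  (`StrictTransform.comap_idealSheaf_X_ideal`) and `τ♯x|_W ≠ 0` in the domain `Γ(X', W)` because
  its non-vanishing locus `W ∩ τ⁻¹(𝔸¹ ∖ 0)` is non-empty (irreducibility);
* `exists_mem_support_basicOpen` — for any `B` over `Y` and `𝔸¹` with a chart
  `Spec ⊕ 𝒥ₙ(U) tⁿ` over an affine `U` on which `K(U)` is prime: the `t⁻¹`-saturation `𝔰` of
  `K(U) · ⊕ 𝒥ₙ(U) tⁿ` is a prime NOT containing `t⁻¹` (its `t^{-1}`-coefficient is `1 ∉ K(U)`,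
  `mem_iSup_colon_iff_forall_coeff_mem`), so — if it misses the irrelevant ideal — the point `𝔰`
  of the chart lies off the vertex, in the support of the strict transform, and in
  `B₋ = {t⁻¹ ≠ 0}` (compare `StrictTransform.exists_mem_support`);
* `nonempty_preimage_subschemeι`, `nonempty_preimage_basicOpen` — hence **the strict transform
  `X'` of the integral `X` meets `B₋`**: over an affine neighbourhood of the generic point of `X`
  (which is off the centre: `isBot_inv_apply_iff`, `support_centre`, `not_isBot_of_isMaxOn`, as in
  `StrictTransform.stub_strictTransform`) the saturation misses the irrelevant ideal;
* `stub_qs_lift` — the assembly: `E = τ^*(x)` for `τ = ι' ≫ (B₊ ↪ B) ≫ t⁻¹`, so `K · 𝒪_{X'} = E^{Dg}`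
  is effective Cartier, `q' := IsBlowup.lift`, and `K = ⊥` would force `E^{Dg} = ⊥`.

All proofs are glue on Mathlib and the tree; no definitions, no named facts.
-/

noncomputable section

open scoped LaurentPolynomial
open LaurentPolynomial CategoryTheory CategoryTheory.Limits AlgebraicGeometry TopologicalSpace
open Literature.AlgebraicGeometry.Resolution

set_option linter.dupNamespace false -- mandated namespace `…Theorems.DatumToEmbedded.<Topic>`

namespace Summit.ResolutionOfSingularities.ResolutionOfSingularities.Theorems.DatumToEmbedded.Lift

universe u

/-! ## Effective Cartier divisors: two generalities -/

section Cartier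

/-- An effective Cartier divisor on a non-empty scheme is not the zero ideal sheaf: a local
generator of the zero ideal is `0`, which is a non-zero-divisor only in the zero ring, while the
sections over a non-empty open are a non-trivial ring. [folklore] -/
theorem ne_bot_of_isEffectiveCartier {X : Scheme.{u}} [Nonempty X] {I : X.IdealSheafData}
    (hI : IsEffectiveCartier I) : I ≠ ⊥ := by
  rintro rfl
  obtain ⟨U, hxU, g, hg, hU⟩ := hI (Classical.arbitrary X)
  rw [Scheme.IdealSheafData.ideal_bot, Pi.bot_apply, eq_comm, Ideal.span_singleton_eq_bot] at hU
  subst hU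
  haveI : Nonempty (U : X.Opens) := ⟨⟨_, hxU⟩⟩
  exact zero_notMem_nonZeroDivisors hg

/-- **Powers of the pull-back of the origin along a non-zero coordinate on an integral scheme are
effective Cartier divisors.** For an integral scheme `X` and `τ : X ⟶ 𝔸¹ = Spec ℤ[x]` with
`τ⁻¹(𝔸¹ ∖ 0)` non-empty, every power of the ideal sheaf `τ^*(x)` is an effective Cartier
divisor: on an affine open `W ∋ x₀` it is generated by `(τ♯x|_W)ⁿ`
(`StrictTransform.comap_idealSheaf_X_ideal`), and `τ♯x|_W ≠ 0` in the domain `Γ(X, W)` since its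
non-vanishing locus `W ∩ τ⁻¹(𝔸¹ ∖ 0)` is a non-empty open (any two non-empty opens of the
irreducible `X` meet). [folklore] -/
theorem isEffectiveCartier_comap_pow {X : Scheme.{u}} [IsIntegral X]
    (τ : X ⟶ Spec (CommRingCat.of (Polynomial ReesFiltration.ZZ.{u})))
    (hτ : ((τ ⁻¹ᵁ PrimeSpectrum.basicOpen (Polynomial.X : Polynomial ReesFiltration.ZZ.{u}) :
      X.Opens) : Set X).Nonempty) (n : ℕ) :
    IsEffectiveCartier (((affineBlowup.idealSheaf
      (Ideal.span {(Polynomial.X : Polynomial ReesFiltration.ZZ.{u})})).comap τ) ^ n) := by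
  intro x
  obtain ⟨W, hW, hxW, -⟩ :=
    exists_isAffineOpen_mem_and_subset (X := X) (x := x) (U := ⊤) (Opens.mem_top x)
  haveI : Nonempty W := ⟨⟨x, hxW⟩⟩
  -- the local generator `τ♯x|_W` is non-zero, hence regular in the domain `Γ(X, W)`
  have ht0 : τ.appLE ⊤ W le_top
      ((Scheme.ΓSpecIso (CommRingCat.of (Polynomial ReesFiltration.ZZ.{u}))).inv Polynomial.X) ≠
        0 := by
    intro h0
    have hbo : X.basicOpen (τ.appLE ⊤ W le_top
        ((Scheme.ΓSpecIso (CommRingCat.of (Polynomial ReesFiltration.ZZ.{u}))).inv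
          Polynomial.X)) = ⊥ := by
      rw [h0, Scheme.basicOpen_zero]
    rw [Scheme.basicOpen_appLE, basicOpen_eq_of_affine] at hbo
    have hne := nonempty_preirreducible_inter W.isOpen
      (τ ⁻¹ᵁ PrimeSpectrum.basicOpen (Polynomial.X : Polynomial ReesFiltration.ZZ.{u})).isOpen
      ⟨x, hxW⟩ hτ
    rw [← Opens.coe_inf, hbo, Opens.coe_bot] at hne
    exact Set.not_nonempty_empty hne
  refine ⟨⟨W, hW⟩, hxW, _, pow_mem (mem_nonZeroDivisors_of_ne_zero ht0) n, ?_⟩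
  rw [Scheme.IdealSheafData.ideal_pow, Pi.pow_apply,
    StrictTransform.comap_idealSheaf_X_ideal τ ⟨W, hW⟩, Ideal.span_singleton_pow]

/-- A point `b` of an open `O ⊆ B` in the support of an ideal sheaf `I`, mapped by `τ : B ⟶ T`
into an open `W ⊆ T`, lifts to a point of the closed subscheme `V(I|_O)` of `O` in the preimage
of `W` under `V(I|_O) ⟶ O ⟶ B ⟶ T`. [folklore] -/
theorem nonempty_preimage_subschemeι {B T : Scheme.{u}} (I : B.IdealSheafData) (O : B.Opens)
    (τ : B ⟶ T) (W : T.Opens) {b : B} (hbO : b ∈ O) (hb : b ∈ I.support) (hbτ : τ b ∈ W) :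
    ((((I.comap O.ι).subschemeι ≫ O.ι ≫ τ) ⁻¹ᵁ W : (I.comap O.ι).subscheme.Opens) :
      Set (I.comap O.ι).subscheme).Nonempty := by
  have hb' : (⟨b, hbO⟩ : O) ∈ ((I.comap O.ι).support : Set O) := by
    rw [Scheme.IdealSheafData.support_comap]
    exact hb
  rw [← Scheme.IdealSheafData.range_subschemeι] at hb'
  obtain ⟨x, hx⟩ := hb'
  refine ⟨x, ?_⟩
  change ((I.comap O.ι).subschemeι ≫ O.ι ≫ τ) x ∈ W
  rw [Scheme.Hom.comp_apply, Scheme.Hom.comp_apply, hx]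
  exact hbτ

end Cartier

/-! ## A point of the strict transform off the vertex and off the exceptional divisor -/

section Chart

variable {Y B : Scheme.{u}} (π : B ⟶ Y)
  (τ : B ⟶ Spec (CommRingCat.of (Polynomial ReesFiltration.ZZ.{u})))
  (R : ReesFiltration Y) (U : Y.affineOpens)
  (φ : Spec (CommRingCat.of (R.sectionsRing U)) ⟶ B) [hφ : IsOpenImmersion φ]
  (hφπ : φ ≫ π =
    Spec.map (CommRingCat.ofHom (algebraMap Γ(Y, U) (R.sectionsRing U))) ≫ U.2.fromSpec)
  (hφA : φ ≫ τ = Spec.map (CommRingCat.ofHom (R.polyToSections U)))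

include hφπ hφA in
/-- **A point of the strict transform in `B₋ ∖ Vertex`.** Let `B` be a scheme over `Y` and
`𝔸¹ = Spec ℤ[x]` with a chart `φ : Spec ⊕ 𝒥ₙ(U) tⁿ ⟶ B` over the affine open `U ⊆ Y`
(`φ ≫ π = Spec(Γ(Y, U) → ⊕ 𝒥ₙ(U) tⁿ) ≫ (U ↪ Y)`, `φ ≫ τ = Spec(x ↦ t⁻¹)`), `K` an ideal sheaf of
`Y` with `K(U)` prime, and `O ⊆ B` an open containing the chart's complement of the vertex. The
`t⁻¹`-saturation `𝔰` of `K(U) · ⊕ 𝒥ₙ(U) tⁿ` is prime (`isPrime_iSup_colon`) and does not contain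
`t⁻¹` (the `t⁻¹`-coefficient of `t⁻¹` is `1 ∉ K(U)`); if it does not contain the irrelevant
ideal, the point `φ 𝔰` lies in `O`, in the support of the strict transform
`⋃ₙ (π^*K : τ^*(x)ⁿ)`, and in `B₋ = τ⁻¹(𝔸¹ ∖ 0)`. [cite: Wlodarczyk2022, 3.3.12] -/
theorem exists_mem_support_basicOpen [IsLocallyNoetherian B] (K : Y.IdealSheafData)
    [(K.ideal U).IsPrime] (O : B.Opens) (hO : φ ''ᵁ R.plusChart U ≤ O)
    (hirr : ¬ (R.filtration U).irrelevant ≤ ⨆ n : ℕ,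
      ((K.ideal U).map (algebraMap Γ(Y, U) (R.sectionsRing U))).colon
        ((Ideal.span {(⟨T (-1), (R.filtration U).T_neg_one_mem_extendedRees⟩ : R.sectionsRing U)} ^ n :
          Ideal (R.sectionsRing U)) : Set (R.sectionsRing U))) :
    ∃ b ∈ O, b ∈ (⨆ n : ℕ, colon (K.comap π) ((affineBlowup.idealSheaf
        (Ideal.span {(Polynomial.X : Polynomial ReesFiltration.ZZ.{u})})).comap τ ^ n)).support ∧
      τ b ∈ PrimeSpectrum.basicOpen (Polynomial.X : Polynomial ReesFiltration.ZZ.{u}) := by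
  haveI hσ := (R.filtration U).isPrime_iSup_colon (K.ideal U)
  let q : PrimeSpectrum (R.sectionsRing U) := ⟨_, hσ⟩
  refine ⟨φ q, hO ⟨q, (R.mem_plusChart_iff U q).mpr hirr, rfl⟩, ?_, ?_⟩
  · -- `φ 𝔰` lies in the support of the strict transform (as in `exists_mem_support`)
    refine (Scheme.IdealSheafData.mem_support_iff_of_mem
      (I := ⨆ n : ℕ, colon (K.comap π) ((affineBlowup.idealSheaf
          (Ideal.span {(Polynomial.X : Polynomial ReesFiltration.ZZ.{u})})).comap τ ^ n))
      (U := ⟨φ ''ᵁ ⊤, (isAffineOpen_top _).image_of_isOpenImmersion φ⟩)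
      (show φ q ∈ φ ''ᵁ ⊤ from ⟨q, trivial, rfl⟩)).mpr ?_
    refine (B.mem_zeroLocus_iff _ _).mpr fun g hg hmem => ?_
    have hg' := (congrArg (g ∈ ·)
      (StrictTransform.iSup_colon_ideal_chart π τ R U φ hφπ hφA K)).mp hg
    rw [Ideal.mem_comap, CommRingCat.hom_comp, RingHom.comp_apply, Scheme.Hom.appIso_hom'] at hg'
    have h1 : q ∈ (Spec (CommRingCat.of (R.sectionsRing U))).basicOpen
        (φ.appLE (φ ''ᵁ ⊤) ⊤ (Scheme.Hom.preimage_image_eq φ ⊤).ge g) := by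
      rw [Scheme.basicOpen_appLE]
      exact ⟨trivial, hmem⟩
    exact (PrimeSpectrum.mem_basicOpen _ q).mp ((basicOpen_eq_of_affine' _).le h1) hg'
  · -- `t⁻¹ ∉ 𝔰`: the `t⁻¹`-coefficient of `t⁻¹` is `1 ∉ K(U)`
    change (φ ≫ τ) q ∈ PrimeSpectrum.basicOpen (Polynomial.X : Polynomial ReesFiltration.ZZ.{u})
    rw [hφA]
    change R.polyToSections U Polynomial.X ∉ q.asIdeal
    rw [R.polyToSections_X U]
    intro hmem
    have h1 := ((R.filtration U).mem_iSup_colon_iff_forall_coeff_mem (K.ideal U) _).mp hmem (-1)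
    change (T (-1) : (Γ(Y, U))[T;T⁻¹]).coeff (-1) ∈ K.ideal U at h1
    rw [T, AddMonoidAlgebra.coeff_single, Finsupp.single_eq_same] at h1
    exact (inferInstance : (K.ideal U).IsPrime).ne_top ((Ideal.eq_top_iff_one _).mpr h1)

end Chart

/-! ## The strict transform of the integral `X` meets `B₋` -/

section Datum

variable {p : ℕ} (D : WeightedResolutionDatum p) {k : Type} [Field k] [CharP k p] [PerfectField k]
  {Y X : Scheme.{0}} (f : Y ⟶ Spec (.of k)) [Smooth f] [IsSeparated f] [QuasiCompact f]
  (i : X ⟶ Y) [IsClosedImmersion i] [IsIntegral X]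
  (hguard : ∃ y : Y, ¬ IsBot (D.inv f i.ker y))
  (R' : ReesFiltration Y) (hR' : R'.ideal = (D.centre f i.ker).piece)

include hguard hR' in
/-- **The strict transform meets `B₋ = {t⁻¹ ≠ 0}`.** For a weighted resolution datum `D`, a closed
immersion `i : X ⟶ Y` of an integral `X` (smooth separated quasi-compact `Y` over a perfect
field), the guard of axiom `(iii)` and the Rees filtration `R'` of the centre, the preimage of
`𝔸¹ ∖ 0` under `t⁻¹ : X' = V(R'.strictTransformPlus (ker i)) ⟶ B₊ ⟶ B ⟶ 𝔸¹` is non-empty: the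
generic point of `X` is off the centre (`isBot_inv_apply_iff`: its local ring, the function
field, is regular; `support_centre`, `not_isBot_of_isMaxOn`), so over an affine neighbourhood
`U₀` of it the `t⁻¹`-saturation of the prime `(ker i)(U₀)` misses the irrelevant ideal, and
`exists_mem_support_basicOpen` provides a point of `B₊ ∩ supp σˢ(ker i) ∩ B₋`.
[cite: Wlodarczyk2022, 3.3.12] -/
theorem nonempty_preimage_basicOpen :
    ((((R'.strictTransformPlus i.ker).subschemeι ≫ R'.plus.ι ≫ R'.toA1) ⁻¹ᵁ
      PrimeSpectrum.basicOpen (Polynomial.X : Polynomial ReesFiltration.ZZ.{0}) :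
        (R'.strictTransformPlus i.ker).subscheme.Opens) :
          Set (R'.strictTransformPlus i.ker).subscheme).Nonempty := by
  -- `B` is locally Noetherian (the centre is a regular weighted centre under the guard)
  haveI : IsLocallyNoetherian Y := LocallyOfFiniteType.isLocallyNoetherian f
  haveI : LocallyOfFiniteType R'.π := WeightedThesis.GlobalCobordantPlus.locallyOfFiniteType_π
    (D.centre f i.ker) R' hR' (D.isRegularWeightedCentre_centre f i.ker hguard)
  haveI : IsLocallyNoetherian R'.cobordantBlowup := LocallyOfFiniteType.isLocallyNoetherian R'.π
  -- the generic point of `X` lies in `X` and off the centre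
  have hξ : i (genericPoint X) ∈ i.ker.support := i.range_subset_ker_support ⟨_, rfl⟩
  have hbot : IsBot (D.inv f i.ker (i (genericPoint X))) := by
    rw [isBot_inv_apply_iff D f i]
    change IsRegularLocalRing X.functionField
    infer_instance
  have hξ' : ∃ n : ℕ, 0 < n ∧ i (genericPoint X) ∉ (R'.ideal n).support := by
    by_contra hcon
    push Not at hcon
    have hmem : i (genericPoint X) ∈ (D.centre f i.ker).support :=
      (ReesAlgebraData.mem_support_iff _).mpr fun n hn => hR' ▸ hcon n hn
    rw [D.support_centre f i.ker hguard] at hmem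
    exact D.not_isBot_of_isMaxOn f i.ker hguard hmem hbot
  -- an affine neighbourhood `U₀` of the generic point: `(ker i)(U₀)` is prime and its
  -- saturation misses the irrelevant ideal
  obtain ⟨U₀, hU₀, hξU₀, -⟩ :=
    exists_isAffineOpen_mem_and_subset (X := Y) (x := i (genericPoint X)) (U := ⊤) trivial
  haveI : (i.ker.ideal ⟨U₀, hU₀⟩).IsPrime :=
    StrictTransform.isPrime_ker_ideal i hξ ⟨U₀, hU₀⟩ hξU₀
  have hirrel : ¬ (R'.filtration ⟨U₀, hU₀⟩).irrelevant ≤ ⨆ n : ℕ,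
      ((i.ker.ideal ⟨U₀, hU₀⟩).map (algebraMap Γ(Y, U₀) (R'.sectionsRing ⟨U₀, hU₀⟩))).colon
        ((Ideal.span {(⟨T (-1), (R'.filtration ⟨U₀, hU₀⟩).T_neg_one_mem_extendedRees⟩ :
          R'.sectionsRing ⟨U₀, hU₀⟩)} ^ n : Ideal (R'.sectionsRing ⟨U₀, hU₀⟩)) :
            Set (R'.sectionsRing ⟨U₀, hU₀⟩)) := by
    intro h
    obtain ⟨n, hn, hξn⟩ := hξ'
    have hle := StrictTransform.ideal_le_of_irrelevant_le R' ⟨U₀, hU₀⟩ i.ker h hn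
    apply hξn
    rw [Scheme.IdealSheafData.mem_support_iff_of_mem (U := ⟨U₀, hU₀⟩) hξU₀,
      Scheme.mem_zeroLocus_iff]
    intro a ha
    have hK := (Scheme.IdealSheafData.mem_support_iff_of_mem (U := ⟨U₀, hU₀⟩) hξU₀).mp hξ
    rw [Scheme.mem_zeroLocus_iff] at hK
    exact hK a (hle ha)
  -- the point of `B₊ ∩ supp σˢ(ker i) ∩ B₋` over `U₀`, lifted to `X'`
  obtain ⟨b, hbO, hb, hbτ⟩ := exists_mem_support_basicOpen R'.π R'.toA1 R' ⟨U₀, hU₀⟩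
    (R'.openCover.f ⟨U₀, hU₀⟩) (hφ := R'.openCover.map_prop ⟨U₀, hU₀⟩) (R'.ι_π ⟨U₀, hU₀⟩)
    (R'.ι_toA1 ⟨U₀, hU₀⟩) i.ker R'.plus (R'.image_plusChart_le_plus ⟨U₀, hU₀⟩) hirrel
  exact nonempty_preimage_subschemeι (R'.strictTransform i.ker) R'.plus R'.toA1 _ hbO hb hbτ

end Datum

/-! ## The stub -/

/-- **STUB `stub_qs_lift`** of the line `Sketch` of crux `DatumToEmbedded`: **the strict transform
maps to the blow-up downstairs.** If the downstairs centre
`K = ker (V(J_{Dg}·𝒪_X) ⟶ X ⟶ V)` pulls back to the `Dg`-th power of the exceptional ideal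
`E = (t⁻¹)|_{X'}` on the integral strict transform `X'` (A3), then `K ≠ ⊥` and every blow-up
`ρ : V' ⟶ V` of `V` along `K` receives `q' : X' ⟶ V'` with `q' ≫ ρ = σX ≫ q`: `E = τ^*(x)` for
the coordinate `τ = t⁻¹ : X' ⟶ B₊ ⟶ B ⟶ 𝔸¹`, which is not identically zero on `X'`
(`nonempty_preimage_basicOpen`), so `K·𝒪_{X'} = E^{Dg}` is an effective Cartier divisor
(`isEffectiveCartier_comap_pow`) and the universal property of the blow-up (`IsBlowup.lift`,
Görtz–Wedhorn Def. 13.90) applies; `K = ⊥` would pull back to the zero ideal sheaf, which is not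
an effective Cartier divisor on the non-empty `X'`. [cite: Wlodarczyk2022, §2.3.3] -/
theorem stub_qs_lift :
    ∀ {p : ℕ} (D : WeightedResolutionDatum p) {k : Type} [Field k] [CharP k p] [PerfectField k]
      {Y X V : Scheme.{0}} (f : Y ⟶ Spec (.of k)) [Smooth f] [IsSeparated f] [QuasiCompact f]
      (i : X ⟶ Y) [IsClosedImmersion i] [IsIntegral X] (q : X ⟶ V) [QuasiCompact q],
      (∃ y : Y, ¬ IsBot (D.inv f i.ker y)) →
      ∀ (R' : ReesFiltration Y), R'.ideal = (D.centre f i.ker).piece →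
      ∀ [IsIntegral (R'.strictTransformPlus i.ker).subscheme]
        (σX : (R'.strictTransformPlus i.ker).subscheme ⟶ X),
        σX ≫ i = (R'.strictTransformPlus i.ker).subschemeι ≫ R'.πPlus →
      ∀ (Dg : ℕ), 0 < Dg →
      (((((D.centre f i.ker).piece Dg).comap i).subschemeι ≫ q).ker).comap (σX ≫ q) =
          (R'.excPlus.comap (R'.strictTransformPlus i.ker).subschemeι) ^ Dg →
      ((((D.centre f i.ker).piece Dg).comap i).subschemeι ≫ q).ker ≠ ⊥ ∧
      ∀ (V' : Scheme.{0}) (ρ : V' ⟶ V),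
        IsBlowup ρ ((((D.centre f i.ker).piece Dg).comap i).subschemeι ≫ q).ker →
        ∃ q' : (R'.strictTransformPlus i.ker).subscheme ⟶ V', q' ≫ ρ = σX ≫ q := by
  intro p D k _ _ _ Y X V f _ _ _ i _ _ q _ hguard R' hR' _ σX _ Dg _ hA3
  -- the exceptional ideal on `X'` is `τ^*(x)` for the coordinate `τ = t⁻¹ : X' ⟶ B₊ ⟶ B ⟶ 𝔸¹`
  have hEeq : R'.excPlus.comap (R'.strictTransformPlus i.ker).subschemeι =
      (affineBlowup.idealSheaf (Ideal.span {Polynomial.X})).comap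
        ((R'.strictTransformPlus i.ker).subschemeι ≫ R'.plus.ι ≫ R'.toA1) := by
    rw [Scheme.IdealSheafData.comap_comp, Scheme.IdealSheafData.comap_comp]
    rfl
  -- `K · 𝒪_{X'} = E^{Dg}` is an effective Cartier divisor
  have hcart : IsEffectiveCartier
      ((((((D.centre f i.ker).piece Dg).comap i).subschemeι ≫ q).ker).comap (σX ≫ q)) := by
    rw [hA3, hEeq]
    exact isEffectiveCartier_comap_pow _ (nonempty_preimage_basicOpen D f i hguard R' hR') Dg
  refine ⟨fun hK => ?_, fun V' ρ hρ => ⟨hρ.lift (σX ≫ q) hcart, hρ.lift_comp _ _⟩⟩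
  rw [hK, Scheme.IdealSheafData.comap_bot] at hcart
  exact ne_bot_of_isEffectiveCartier hcart rfl

end Summit.ResolutionOfSingularities.ResolutionOfSingularities.Theorems.DatumToEmbedded.Lift

end
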